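import Summits.Ventures.HSemireg.S4BridgeWeilFamilyReachPeriodConstruction
import Literature.AlgebraicGeometry.HodgeTheory.WeilFamilyPeriodConstructionAtWeilType
import HarnessLib

/-!
# The cell's Weil-family trust base from ONE NAMED Literature fact — (J1), Deligne's period construction of the Weil
# family at a point of Weil type

Family `hodge`, venture `HSemireg` (computation cell `pub-hsemireg`, track «S4-PUSH» (iii), seat s4-bridge-2;
`run/shared/lean/pub/pub-hsemireg/s4push/B2-TYPING-s4-bridge-2.md` §18 and §24). TWO theorems, one line each: the apex
theorem 1 `weilFamilyReach_similar_of_levelConstructions_of_periodSurjective` (`S4BridgeWeilFamilyReachPeriodConstruction`)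
and its four-fact form `weilFamilies_and_reachSimilar_of_periodConstructionAtWeilType_only` (§3 of the same apex,
appended) READ WITH A NAME for their inline hypothesis `h` — the Literature
named fact `HodgeTheory.deligne1982_weilFamily_periodConstructionAtWeilType` (`Literature/AlgebraicGeometry/HodgeTheory/
WeilFamilyPeriodConstructionAtWeilType`), which is that `h` BYTE-FOR-BYTE (the proof terms below are those theorems applied
to the hypothesis with no glue; the kernel checks the identity). PURPOSE: consumers of `HodgeTheory.weilFamilyReach_similar`
(the (B1)/(B2⁺) component rows), of `weilFamilyReach_hyperbolic` (the split rows) and of M3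
(`deligne1982_weilFamily_levelStructure`, hence `…_kAction`, `…_globalAction`, `…_hodgeWeilSection`, `…_flatWeilSection`)
can now write their trust base as ONE Literature name `(hJ1 : …AtWeilType)`; the D-0026 debt ledger carries (J1) BY NAME
(+1, lead ruling R-111 (c), bus l.14748); a future constructor targets `…_holds`.

HONEST FRAMING: nothing here bears on any case of the Hodge conjecture; HC / HC_CM / HC_AV are NOT proved; no object of
the cell is certified; no σ; (J1) stays an UNPROVED HYPOTHESIS OF RECORD (the tree constructs no moduli space of abelian
varieties, no universal abelian scheme, no period map).

AS PRINTED — the citation record is that of the imported files (Deligne's proof of Thm. 4.8, Milne's TeXed ed.,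
rev. 2018, pp. 32–34 = LNM 900 §4; van Geemen 4.9, 5.3–5.5); this file adds no quotation and no reading.

## References

* [Deligne1982HodgeCycles] P. Deligne (notes by J. S. Milne), *Hodge cycles on abelian varieties*, LNM 900 (1982), §4,
  Prop. 4.4 and proof of Thm. 4.8 (Milne's TeXed ed., rev. 2018, pp. 32–34).
* [vanGeemen1994HodgeAV] B. van Geemen, *An introduction to the Hodge conjecture for abelian varieties*, LNM 1594 (1994),
  4.9, 5.3–5.5.
-/

noncomputable section

open Literature.AlgebraicGeometry.HodgeTheory

namespace Summit.Ventures.HSemireg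

/-- **(J1) NAMED ⟹ `weilFamilyReach_similar`.** Deligne's period construction of the Weil family at every point of Weil
type `(n, n)` — the Literature named fact `deligne1982_weilFamily_periodConstructionAtWeilType` (UNPROVED hypothesis of
record; clauses (1) family + closed immersion + `e' : P ≅ 𝒳_{s₀}`, (2) global `√-d` with fibre charts, (4ℓ) integral
level-`n'` structure, `n' ≥ 3`, (5U) period surjectivity, (6) the polarization datum) — implies the cell's named reach
fact `HodgeTheory.weilFamilyReach_similar`. Proof: the apex theorem
`weilFamilyReach_similar_of_levelConstructions_of_periodSurjective`, whose inline hypothesis `h` this named fact is,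
byte for byte. CONDITIONAL on (J1) by name; nothing else is assumed.
[cite: Deligne1982HodgeCycles, §4 Prop. 4.4 and proof of Thm. 4.8 (Milne's TeXed ed., rev. 2018, pp. 32–34; LNM 900 §4)]
[cite: vanGeemen1994HodgeAV, 4.9, 5.3–5.5, (5.4.1) and 5.8–5.11] -/
theorem weilFamilyReach_similar_of_deligne1982_weilFamily_periodConstructionAtWeilType
    (hJ1 : deligne1982_weilFamily_periodConstructionAtWeilType) : weilFamilyReach_similar :=
  weilFamilyReach_similar_of_levelConstructions_of_periodSurjective hJ1

/-- **(J1) NAMED ⟹ ALL FOUR Weil-family named facts of the cell.** The same named fact implies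
`deligne1982_weilFamily_levelStructure ∧ weilFamilyReach_hyperbolic ∧ weilFamily_hyperbolic_weilSystem_reach ∧
weilFamilyReach_similar`: the four-fact form `weilFamilies_and_reachSimilar_of_periodConstructionAtWeilType_only`, whose
inline hypothesis `h` this named fact is, byte for byte (M3's one use of the package is at a Weil-type point by
[Deligne1982HodgeCycles] Prop. 4.4; the reach reductions use hyperbolic, hence Weil-type, points). CONDITIONAL on (J1)
by name; nothing else is assumed; the four facts stay UNPROVED — this reduces them to (J1), it certifies nothing.
[cite: Deligne1982HodgeCycles, §4 Prop. 4.4 and proof of Thm. 4.8 (Milne's TeXed ed., rev. 2018, pp. 32–34; LNM 900 §4)]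
[cite: vanGeemen1994HodgeAV, 4.9, Lemma 5.2 (4) and 5.4, 5.3–5.11] -/
theorem weilFamilies_and_reachSimilar_of_deligne1982_weilFamily_periodConstructionAtWeilType
    (hJ1 : deligne1982_weilFamily_periodConstructionAtWeilType) :
    deligne1982_weilFamily_levelStructure ∧ weilFamilyReach_hyperbolic ∧
      weilFamily_hyperbolic_weilSystem_reach ∧ weilFamilyReach_similar :=
  weilFamilies_and_reachSimilar_of_periodConstructionAtWeilType_only hJ1

end Summit.Ventures.HSemireg

end
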